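import Summits.Ventures.CertifiedManyBodySolver.Observables.PinningFieldResponseBracket
import Summits.Ventures.CertifiedManyBodySolver.Observables.SourcedOrderParameterCeilingInputsTTPrime
import Summits.Ventures.CertifiedManyBodySolver.Observables.PinningFieldTangentChord
import HarnessLib

/-!
# The Hellmann–Feynman bracket for every torus-limit GROUND STATE of the `t–t′` `d`-wave sourced torus
# (`dWaveSourceTorusTT'`): the `t′ ≠ 0` twin of `PinningFieldResponseBracketDWave.lean`, plus ROW-FED forms

HONEST FRAMING: first certified bounds; not a superconductivity verdict; every number certified or labelled float.

Venture `CertifiedManyBodySolver`, obs-theory lane of the Hubbard cuprate cell (rung CQ, anchor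
`A0 = (U, n, t′) = (8, 7/8, −1/4)`), seat `hubbard-cq-obsth-3` (row «Hellmann–Feynman bracket → m_d(h) two-sided node»,
split of record: obsth-3 = the `t′`-twins). The generic file `PinningFieldResponseBracket.lean` (hubbard-obs-pin-2) proves
the bracket for ANY Hermitian `K_L`; `PinningFieldResponseBracketDWave.lean` specialises it to the `t′ = 0` torus
`dWaveSourceTorus`. THIS FILE specialises it to the `t–t′` pinning-field torus
`A_L(h) = dWaveSourceTorusTT' L t′ U μ h = (H(1,t′,U) − μN) − h(Δ_d + Δ_dᴴ)` (`DWaveSourceNNNHopping.lean`,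
`PinningFieldPairingOrder.dWaveSourceTorusTT'_eq`), i.e. `K_L = hubbardTorusTT' L 1 t′ U − μN`
(`isHermitian_hubbardTorusTT'_sub_smul_totalNumber`), and adds the ROW-FED forms the pilots' certificates plug into.

* §1 EVERY TORUS-LIMIT GROUND STATE (eventual-certificate shape `∃ L₀, ∀ L ≥ L₀`): for `ω` a torus limit of translation
  averages of unit ground-state vectors `ψ_{Ls j}` of `A_{Ls j}(h)`, `Ls → ∞`: cap `E₀(A_L(h)) ≤ u·L²` and cut
  `ℓ·L² ≤ E₀(A_L(h₁))` at `h₁ < h` give `(ℓ − u)/(2(h − h₁)) ≤ Re ω(P₀^d)`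
  (`le_re_expect_localPairAt_of_dWaveSourceTT'_groundStates`); cut at `h₂ > h` gives the ceiling
  `Re ω(P₀^d) ≤ (u − ℓ)/(2(h₂ − h))`; two-sided; SIGN node `0 ≤ Re ω(P₀^d)` at `h > 0`.
* §2 ROW-FED forms along a side progression `q ∣ Ls j` (the shape of `Rows/SourcedTorusRows`: `SourcedEnergyLowerRow` /
  `SourcedEnergyUpperRow`, every side `L ≥ L₀` with `q ∣ L` — trial states tiling the torus by `a × b` blocks give
  `q = lcm(a,b) ∣ L`): `le_re_expect_localPairAt_of_dWaveSourceTT'_groundStates_of_rows` and the ceiling twin; and the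
  TANGENT/MEAN-DENSITY corollary `le_re_expect_localPairAt_of_tangentRow_of_meanDensityCap_TT'`: a tangent floor row
  `(ℓ − nμ)` at `h = 0` and a mean-density cap row `(u − nμ)` AT `h` give `(ℓ − u)/(2h) ≤ Re ω(P₀^d)` for every
  torus-limit ground state at chemical potential `μ` along the progression — the `μ`-terms CANCEL
  (`PinningFieldTangentChord.lean` is the finite-torus form).
* §3 TODAY'S CAP from the canonical source-free table at `t′` (Legendre + «the source never raises the energy»,
  `eventually_groundEnergy_dWaveSourceTorusTT'_zero_le`): `exists_groundEnergy_dWaveSourceTorusTT'_le_of_canonical_upper`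
  and the fed ceiling `re_expect_localPairAt_le_of_canonical_upper_of_sourced_lower_TT'`
  (`Re ω(P₀^d) ≤ (hi − μn − ℓ)/(2(h₂ − h))` from ANY canonical upper `e(1,t′,U,n) ≤ hi` and ONE sourced lower at `h₂ > h`).
* §4 HONESTY (what the FLOOR side needs): a cut below `h` never beats a cap inherited from the source-free problem
  (`cut_le_cap_of_sourceFree_cap_TT'`, `floor_nonpos_of_sourceFree_cap_TT'`): a positive floor needs a SOURCED cap
  strictly below the source-free lower edge.

Dedup: the finite-torus / stair (`liminf_L`) forms at `t′` are `SourcedOrderParameterFloorTTPrime.lean` and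
`PinningFieldChords.lean`; the infinite-volume TI-class forms are `TISourcedMinimiserChordFloor.lean` /
`TIGrandCanonicalChordFloor.lean`; nothing of those is restated. No definition, no named fact, no `sorry`.

References: T. Koma, H. Tasaki, J. Stat. Phys. 76 (1994) 745, §1 [cite: KomaTasaki1994, §1]; R. B. Griffiths,
Phys. Rev. 152 (1966) 240, §II [cite: Griffiths1966, §II]; H. Tasaki, *Physics and Mathematics of Quantum Many-Body
Systems* (2020), §2.1 [cite: Tasaki2020, §2.1]; O. Bratteli, D. W. Robinson, *OAQSM 2* (1997), §6.2.4 (mean of a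
local observable over torus translations) [cite: BratteliRobinsonII1997, §6.2.4].
-/

noncomputable section

namespace Summit.Ventures.CertifiedManyBodySolver.Observables

open Matrix Literature.MathematicalPhysics.QuantumLattice Literature.Probability.LatticeModels
open Literature.MathematicalPhysics.QuantumLattice.HubbardWave0 ThermodynamicLimit Filter Topology
open scoped ComplexOrder BigOperators

/-! ### §1 Every torus-limit ground state of `dWaveSourceTorusTT'` -/

section GroundStates

variable {t' U μ : ℝ}

/-- The cap hypothesis of the generic bracket for ground-state vectors of `dWaveSourceTorusTT'`: an eventual UPPER bound
`E₀(A_L(h)) ≤ u·L²` on the sourced ground energies is a cap for every family of unit ground-state vectors.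
[cite: Tasaki2020, §2.1] -/
theorem dWaveSourceTT'_cap_of_groundStates {ψ : ∀ L, Fock (Orb (FermionTorus 2 L))} {Ls : ℕ → ℕ}
    (hLs : Tendsto Ls atTop atTop) {h : ℝ}
    (hgs : ∀ (j : ℕ) [NeZero (Ls j)], dWaveSourceTorusTT' (Ls j) t' U μ h *ᵥ ψ (Ls j) =
      (((dWaveSourceTorusTT' (Ls j) t' U μ h).groundEnergy : ℝ) : ℂ) • ψ (Ls j))
    (h1 : ∀ j, star (ψ (Ls j)) ⬝ᵥ ψ (Ls j) = 1) {u : ℝ}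
    (hcapE : ∃ L₀ : ℕ, ∀ (L : ℕ) [NeZero L], L₀ ≤ L → (dWaveSourceTorusTT' L t' U μ h).groundEnergy ≤ u * (L : ℝ) ^ 2) :
    ∃ j₀ : ℕ, ∀ (j : ℕ) [NeZero (Ls j)], j₀ ≤ j →
      (expect ((hubbardTorusTT' (Ls j) 1 t' U - (μ : ℂ) • totalNumber) - (h : ℂ) •
        (pairField dWaveFormFactor (Ls j) + (pairField dWaveFormFactor (Ls j))ᴴ)) (ψ (Ls j))).re ≤
          u * ((Ls j : ℕ) : ℝ) ^ 2 := by
  obtain ⟨L₀, hL₀⟩ := hcapE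
  obtain ⟨j₀, hj₀⟩ := Filter.eventually_atTop.1 (hLs.eventually_ge_atTop L₀)
  refine ⟨j₀, fun j _ hj => ?_⟩
  rw [← dWaveSourceTorusTT'_eq, expect, re_rayleigh_eq_groundEnergy_of_eigen (h1 j) (hgs j)]
  exact hL₀ (Ls j) (hj₀ j hj)

/-- **UPPER bracket for torus-limit ground states of the `t–t′` `d`-wave sourced torus.** Let `ω` be a torus limit of
translation averages of unit ground-state vectors `ψ_{Ls j}` of `A_{Ls j}(h) = dWaveSourceTorusTT' (Ls j) t′ U μ h`,
`Ls → ∞`; let `E₀(A_L(h)) ≤ u·L²` and `ℓ·L² ≤ E₀(A_L(h₂))` for all large `L`, `h < h₂`. Then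
`Re ω(P₀^d) ≤ (u − ℓ)/(2(h₂ − h))`. [cite: KomaTasaki1994, §1] -/
theorem re_expect_localPairAt_le_of_dWaveSourceTT'_groundStates {ω : InfVolFermionState 2}
    {ψ : ∀ L, Fock (Orb (FermionTorus 2 L))} {Ls : ℕ → ℕ} (hω : ω.IsTorusLimitOf ψ Ls)
    (hLs : Tendsto Ls atTop atTop) {h : ℝ}
    (hgs : ∀ (j : ℕ) [NeZero (Ls j)], dWaveSourceTorusTT' (Ls j) t' U μ h *ᵥ ψ (Ls j) =
      (((dWaveSourceTorusTT' (Ls j) t' U μ h).groundEnergy : ℝ) : ℂ) • ψ (Ls j))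
    (h1 : ∀ j, star (ψ (Ls j)) ⬝ᵥ ψ (Ls j) = 1) {h₂ u ℓ : ℝ} (hlt : h < h₂)
    (hcap : ∃ L₀ : ℕ, ∀ (L : ℕ) [NeZero L], L₀ ≤ L → (dWaveSourceTorusTT' L t' U μ h).groundEnergy ≤ u * (L : ℝ) ^ 2)
    (hcut : ∃ L₀ : ℕ, ∀ (L : ℕ) [NeZero L], L₀ ≤ L → ℓ * (L : ℝ) ^ 2 ≤ (dWaveSourceTorusTT' L t' U μ h₂).groundEnergy) :
    (ω.expect (pairRegion (insert (0 : Site 2) unitSteps) 0)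
        (localPairAt (insert (0 : Site 2) unitSteps) dWaveFormFactor 0)).re ≤ (u - ℓ) / (2 * (h₂ - h)) :=
  re_expect_localPairAt_le_of_sourced_cap_of_cut dWaveFormFactor
    (fun L => hubbardTorusTT' L 1 t' U - (μ : ℂ) • totalNumber)
    (fun L _ => isHermitian_hubbardTorusTT'_sub_smul_totalNumber L t' U μ) hω hLs h1 hlt
    (dWaveSourceTT'_cap_of_groundStates hLs hgs h1 hcap) hcut

/-- **LOWER bracket for torus-limit ground states of the `t–t′` `d`-wave sourced torus**: with `ℓ·L² ≤ E₀(A_L(h₁))`,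
`h₁ < h`, and the cap `E₀(A_L(h)) ≤ u·L²` (both for all large `L`): `(ℓ − u)/(2(h − h₁)) ≤ Re ω(P₀^d)`.
[cite: KomaTasaki1994, §1] -/
theorem le_re_expect_localPairAt_of_dWaveSourceTT'_groundStates {ω : InfVolFermionState 2}
    {ψ : ∀ L, Fock (Orb (FermionTorus 2 L))} {Ls : ℕ → ℕ} (hω : ω.IsTorusLimitOf ψ Ls)
    (hLs : Tendsto Ls atTop atTop) {h : ℝ}
    (hgs : ∀ (j : ℕ) [NeZero (Ls j)], dWaveSourceTorusTT' (Ls j) t' U μ h *ᵥ ψ (Ls j) =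
      (((dWaveSourceTorusTT' (Ls j) t' U μ h).groundEnergy : ℝ) : ℂ) • ψ (Ls j))
    (h1 : ∀ j, star (ψ (Ls j)) ⬝ᵥ ψ (Ls j) = 1) {h₁ u ℓ : ℝ} (hlt : h₁ < h)
    (hcap : ∃ L₀ : ℕ, ∀ (L : ℕ) [NeZero L], L₀ ≤ L → (dWaveSourceTorusTT' L t' U μ h).groundEnergy ≤ u * (L : ℝ) ^ 2)
    (hcut : ∃ L₀ : ℕ, ∀ (L : ℕ) [NeZero L], L₀ ≤ L → ℓ * (L : ℝ) ^ 2 ≤ (dWaveSourceTorusTT' L t' U μ h₁).groundEnergy) :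
    (ℓ - u) / (2 * (h - h₁)) ≤ (ω.expect (pairRegion (insert (0 : Site 2) unitSteps) 0)
        (localPairAt (insert (0 : Site 2) unitSteps) dWaveFormFactor 0)).re :=
  le_re_expect_localPairAt_of_sourced_cut_of_cap dWaveFormFactor
    (fun L => hubbardTorusTT' L 1 t' U - (μ : ℂ) • totalNumber)
    (fun L _ => isHermitian_hubbardTorusTT'_sub_smul_totalNumber L t' U μ) hω hLs h1 hlt
    (dWaveSourceTT'_cap_of_groundStates hLs hgs h1 hcap) hcut

/-- **Two-sided bracket for torus-limit ground states of the `t–t′` `d`-wave sourced torus** (three certified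
energies: cuts at `h₁ < h < h₂`, cap at `h`). [cite: KomaTasaki1994, §1] -/
theorem re_expect_localPairAt_mem_Icc_of_dWaveSourceTT'_groundStates {ω : InfVolFermionState 2}
    {ψ : ∀ L, Fock (Orb (FermionTorus 2 L))} {Ls : ℕ → ℕ} (hω : ω.IsTorusLimitOf ψ Ls)
    (hLs : Tendsto Ls atTop atTop) {h : ℝ}
    (hgs : ∀ (j : ℕ) [NeZero (Ls j)], dWaveSourceTorusTT' (Ls j) t' U μ h *ᵥ ψ (Ls j) =
      (((dWaveSourceTorusTT' (Ls j) t' U μ h).groundEnergy : ℝ) : ℂ) • ψ (Ls j))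
    (h1 : ∀ j, star (ψ (Ls j)) ⬝ᵥ ψ (Ls j) = 1) {h₁ h₂ u ℓ₁ ℓ₂ : ℝ} (hlo : h₁ < h) (hhi : h < h₂)
    (hcap : ∃ L₀ : ℕ, ∀ (L : ℕ) [NeZero L], L₀ ≤ L → (dWaveSourceTorusTT' L t' U μ h).groundEnergy ≤ u * (L : ℝ) ^ 2)
    (hcut₁ : ∃ L₀ : ℕ, ∀ (L : ℕ) [NeZero L], L₀ ≤ L → ℓ₁ * (L : ℝ) ^ 2 ≤ (dWaveSourceTorusTT' L t' U μ h₁).groundEnergy)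
    (hcut₂ : ∃ L₀ : ℕ, ∀ (L : ℕ) [NeZero L], L₀ ≤ L → ℓ₂ * (L : ℝ) ^ 2 ≤ (dWaveSourceTorusTT' L t' U μ h₂).groundEnergy) :
    (ω.expect (pairRegion (insert (0 : Site 2) unitSteps) 0)
        (localPairAt (insert (0 : Site 2) unitSteps) dWaveFormFactor 0)).re ∈
      Set.Icc ((ℓ₁ - u) / (2 * (h - h₁))) ((u - ℓ₂) / (2 * (h₂ - h))) :=
  ⟨le_re_expect_localPairAt_of_dWaveSourceTT'_groundStates hω hLs hgs h1 hlo hcap hcut₁,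
    re_expect_localPairAt_le_of_dWaveSourceTT'_groundStates hω hLs hgs h1 hhi hcap hcut₂⟩

/-- **Sign node**: at `h > 0` every torus-limit ground state of the `t–t′` `d`-wave sourced torus has `0 ≤ Re ω(P₀^d)`
(the lower bracket with `h₁ = 0`, cut `ℓ = E₀(A_L(0))/L²` and cap = the ground energy, using `E₀(A_L(h)) ≤ E₀(A_L(0))` —
the source never raises the energy, `groundEnergy_dWaveSourceTorusTT'_le`). [cite: KomaTasaki1994, §1] -/
theorem re_expect_localPairAt_nonneg_of_dWaveSourceTT'_groundStates {ω : InfVolFermionState 2}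
    {ψ : ∀ L, Fock (Orb (FermionTorus 2 L))} {Ls : ℕ → ℕ} (hω : ω.IsTorusLimitOf ψ Ls)
    (hLs : Tendsto Ls atTop atTop) {h : ℝ} (hh : 0 < h)
    (hgs : ∀ (j : ℕ) [NeZero (Ls j)], dWaveSourceTorusTT' (Ls j) t' U μ h *ᵥ ψ (Ls j) =
      (((dWaveSourceTorusTT' (Ls j) t' U μ h).groundEnergy : ℝ) : ℂ) • ψ (Ls j))
    (h1 : ∀ j, star (ψ (Ls j)) ⬝ᵥ ψ (Ls j) = 1) :
    0 ≤ (ω.expect (pairRegion (insert (0 : Site 2) unitSteps) 0)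
        (localPairAt (insert (0 : Site 2) unitSteps) dWaveFormFactor 0)).re := by
  set Λ := pairRegion (insert (0 : Site 2) unitSteps) 0
  set P : FermionOp Λ := localPairAt (insert (0 : Site 2) unitSteps) dWaveFormFactor 0
  have hlim : Tendsto (fun j => (torusAvgExpect (Ls j) Λ P (ψ (Ls j))).re) atTop (𝓝 (ω.expect Λ P).re) :=
    (Complex.continuous_re.tendsto _).comp (hω Λ P)
  refine ge_of_tendsto hlim ?_
  filter_upwards [eventually_injOn_proj_of_tendsto Λ hLs, hLs.eventually_ge_atTop 1] with j hInj hjL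
  haveI : NeZero (Ls j) := ⟨by omega⟩
  rw [torusAvgExpect_eq]
  have hL : (0 : ℝ) < ((Ls j : ℕ) : ℝ) ^ 2 := cast_sq_pos_of_neZero (Ls j)
  have hcap : (expect ((hubbardTorusTT' (Ls j) 1 t' U - (μ : ℂ) • totalNumber) - (h : ℂ) •
      (pairField dWaveFormFactor (Ls j) + (pairField dWaveFormFactor (Ls j))ᴴ)) (ψ (Ls j))).re ≤
      ((dWaveSourceTorusTT' (Ls j) t' U μ h).groundEnergy / ((Ls j : ℕ) : ℝ) ^ 2) * ((Ls j : ℕ) : ℝ) ^ 2 := by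
    rw [← dWaveSourceTorusTT'_eq, expect, re_rayleigh_eq_groundEnergy_of_eigen (h1 j) (hgs j),
      div_mul_cancel₀ _ hL.ne']
  have hcut : ((dWaveSourceTorusTT' (Ls j) t' U μ 0).groundEnergy / ((Ls j : ℕ) : ℝ) ^ 2) * ((Ls j : ℕ) : ℝ) ^ 2 ≤
      ((hubbardTorusTT' (Ls j) 1 t' U - (μ : ℂ) • totalNumber) - ((0 : ℝ) : ℂ) •
        (pairField dWaveFormFactor (Ls j) + (pairField dWaveFormFactor (Ls j))ᴴ)).groundEnergy := by
    rw [← dWaveSourceTorusTT'_eq, div_mul_cancel₀ _ hL.ne']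
  have hfin := le_re_torusAvgExpectAt_localPairAt_of_cut_of_cap dWaveFormFactor
    (isHermitian_hubbardTorusTT'_sub_smul_totalNumber (Ls j) t' U μ) hInj hh (h1 j) hcap hcut
  refine le_trans ?_ hfin
  have hE := groundEnergy_dWaveSourceTorusTT'_le (L := Ls j) t' U μ h
  have hnum : 0 ≤ (dWaveSourceTorusTT' (Ls j) t' U μ 0).groundEnergy / ((Ls j : ℕ) : ℝ) ^ 2 -
      (dWaveSourceTorusTT' (Ls j) t' U μ h).groundEnergy / ((Ls j : ℕ) : ℝ) ^ 2 := by
    rw [← sub_div]; exact div_nonneg (sub_nonneg.2 hE) hL.le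
  have hden : 0 < 2 * (h - 0) := by linarith
  exact div_nonneg hnum hden.le

end GroundStates

/-! ### §2 Row-fed forms along a side progression `q ∣ Ls j` -/

section Rows

variable {t' U : ℝ}

/-- **LOWER bracket fed by ROWS along a side progression.** Let `ω` be a torus limit of translation averages of unit
ground-state vectors `ψ_{Ls j}` of `dWaveSourceTorusTT' (Ls j) t′ U μ h`, `Ls → ∞`, along sides with `q ∣ Ls j`. A floor
row `SourcedEnergyLowerRow t′ U μ h₁ q L₀ lo` at `h₁ < h` and a cap row `SourcedEnergyUpperRow t′ U μ h q L₁ hi` AT the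
field give `(lo − hi)/(2(h − h₁)) ≤ Re ω(P₀^d)`. [cite: KomaTasaki1994, §1] [cite: Griffiths1966, §II] -/
theorem le_re_expect_localPairAt_of_dWaveSourceTT'_groundStates_of_rows (μ : ℝ) {q L₀ L₁ : ℕ}
    {ω : InfVolFermionState 2} {ψ : ∀ L, Fock (Orb (FermionTorus 2 L))} {Ls : ℕ → ℕ} (hω : ω.IsTorusLimitOf ψ Ls)
    (hLs : Tendsto Ls atTop atTop) (hq : ∀ j, q ∣ Ls j) {h : ℝ}
    (hgs : ∀ (j : ℕ) [NeZero (Ls j)], dWaveSourceTorusTT' (Ls j) t' U μ h *ᵥ ψ (Ls j) =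
      (((dWaveSourceTorusTT' (Ls j) t' U μ h).groundEnergy : ℝ) : ℂ) • ψ (Ls j))
    (h1 : ∀ j, star (ψ (Ls j)) ⬝ᵥ ψ (Ls j) = 1) {h₁ : ℝ} (hlt : h₁ < h) {lo hi : ℚ}
    (hlo : SourcedEnergyLowerRow t' U μ h₁ q L₀ lo) (hhi : SourcedEnergyUpperRow t' U μ h q L₁ hi) :
    (((lo : ℚ) : ℝ) - hi) / (2 * (h - h₁)) ≤ (ω.expect (pairRegion (insert (0 : Site 2) unitSteps) 0)
        (localPairAt (insert (0 : Site 2) unitSteps) dWaveFormFactor 0)).re := by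
  set Λ := pairRegion (insert (0 : Site 2) unitSteps) 0
  set P : FermionOp Λ := localPairAt (insert (0 : Site 2) unitSteps) dWaveFormFactor 0
  have hlim : Tendsto (fun j => (torusAvgExpect (Ls j) Λ P (ψ (Ls j))).re) atTop (𝓝 (ω.expect Λ P).re) :=
    (Complex.continuous_re.tendsto _).comp (hω Λ P)
  refine ge_of_tendsto hlim ?_
  filter_upwards [eventually_injOn_proj_of_tendsto Λ hLs, hLs.eventually_ge_atTop (max (max L₀ L₁) 1)]
    with j hInj hjL
  haveI : NeZero (Ls j) := ⟨by omega⟩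
  rw [torusAvgExpect_eq]
  have hcap : (expect ((hubbardTorusTT' (Ls j) 1 t' U - (μ : ℂ) • totalNumber) - (h : ℂ) •
      (pairField dWaveFormFactor (Ls j) + (pairField dWaveFormFactor (Ls j))ᴴ)) (ψ (Ls j))).re ≤
      ((hi : ℚ) : ℝ) * ((Ls j : ℕ) : ℝ) ^ 2 := by
    rw [← dWaveSourceTorusTT'_eq, expect, re_rayleigh_eq_groundEnergy_of_eigen (h1 j) (hgs j)]
    exact sourcedTorusEnergyUpperRow_iff.1 (hhi (Ls j) (by omega) (hq j))
  have hcut : ((lo : ℚ) : ℝ) * ((Ls j : ℕ) : ℝ) ^ 2 ≤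
      ((hubbardTorusTT' (Ls j) 1 t' U - (μ : ℂ) • totalNumber) - (h₁ : ℂ) •
        (pairField dWaveFormFactor (Ls j) + (pairField dWaveFormFactor (Ls j))ᴴ)).groundEnergy := by
    rw [← dWaveSourceTorusTT'_eq]
    exact sourcedTorusEnergyLowerRow_iff.1 (hlo (Ls j) (by omega) (hq j))
  exact le_re_torusAvgExpectAt_localPairAt_of_cut_of_cap dWaveFormFactor
    (isHermitian_hubbardTorusTT'_sub_smul_totalNumber (Ls j) t' U μ) hInj hlt (h1 j) hcap hcut

/-- **UPPER bracket fed by ROWS along a side progression**: a cap row `SourcedEnergyUpperRow t′ U μ h q L₁ hi` AT the field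
and a floor row `SourcedEnergyLowerRow t′ U μ h₂ q L₀ lo` at `h₂ > h` give `Re ω(P₀^d) ≤ (hi − lo)/(2(h₂ − h))` for every
torus-limit ground state along sides with `q ∣ Ls j`. [cite: KomaTasaki1994, §1] [cite: Griffiths1966, §II] -/
theorem re_expect_localPairAt_le_of_dWaveSourceTT'_groundStates_of_rows (μ : ℝ) {q L₀ L₁ : ℕ}
    {ω : InfVolFermionState 2} {ψ : ∀ L, Fock (Orb (FermionTorus 2 L))} {Ls : ℕ → ℕ} (hω : ω.IsTorusLimitOf ψ Ls)
    (hLs : Tendsto Ls atTop atTop) (hq : ∀ j, q ∣ Ls j) {h : ℝ}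
    (hgs : ∀ (j : ℕ) [NeZero (Ls j)], dWaveSourceTorusTT' (Ls j) t' U μ h *ᵥ ψ (Ls j) =
      (((dWaveSourceTorusTT' (Ls j) t' U μ h).groundEnergy : ℝ) : ℂ) • ψ (Ls j))
    (h1 : ∀ j, star (ψ (Ls j)) ⬝ᵥ ψ (Ls j) = 1) {h₂ : ℝ} (hlt : h < h₂) {lo hi : ℚ}
    (hhi : SourcedEnergyUpperRow t' U μ h q L₁ hi) (hlo : SourcedEnergyLowerRow t' U μ h₂ q L₀ lo) :
    (ω.expect (pairRegion (insert (0 : Site 2) unitSteps) 0)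
        (localPairAt (insert (0 : Site 2) unitSteps) dWaveFormFactor 0)).re ≤ (((hi : ℚ) : ℝ) - lo) / (2 * (h₂ - h)) := by
  set Λ := pairRegion (insert (0 : Site 2) unitSteps) 0
  set P : FermionOp Λ := localPairAt (insert (0 : Site 2) unitSteps) dWaveFormFactor 0
  have hlim : Tendsto (fun j => (torusAvgExpect (Ls j) Λ P (ψ (Ls j))).re) atTop (𝓝 (ω.expect Λ P).re) :=
    (Complex.continuous_re.tendsto _).comp (hω Λ P)
  refine le_of_tendsto hlim ?_
  filter_upwards [eventually_injOn_proj_of_tendsto Λ hLs, hLs.eventually_ge_atTop (max (max L₀ L₁) 1)]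
    with j hInj hjL
  haveI : NeZero (Ls j) := ⟨by omega⟩
  rw [torusAvgExpect_eq]
  have hcap : (expect ((hubbardTorusTT' (Ls j) 1 t' U - (μ : ℂ) • totalNumber) - (h : ℂ) •
      (pairField dWaveFormFactor (Ls j) + (pairField dWaveFormFactor (Ls j))ᴴ)) (ψ (Ls j))).re ≤
      ((hi : ℚ) : ℝ) * ((Ls j : ℕ) : ℝ) ^ 2 := by
    rw [← dWaveSourceTorusTT'_eq, expect, re_rayleigh_eq_groundEnergy_of_eigen (h1 j) (hgs j)]
    exact sourcedTorusEnergyUpperRow_iff.1 (hhi (Ls j) (by omega) (hq j))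
  have hcut : ((lo : ℚ) : ℝ) * ((Ls j : ℕ) : ℝ) ^ 2 ≤
      ((hubbardTorusTT' (Ls j) 1 t' U - (μ : ℂ) • totalNumber) - (h₂ : ℂ) •
        (pairField dWaveFormFactor (Ls j) + (pairField dWaveFormFactor (Ls j))ᴴ)).groundEnergy := by
    rw [← dWaveSourceTorusTT'_eq]
    exact sourcedTorusEnergyLowerRow_iff.1 (hlo (Ls j) (by omega) (hq j))
  exact re_torusAvgExpectAt_localPairAt_le_of_cap_of_cut dWaveFormFactor
    (isHermitian_hubbardTorusTT'_sub_smul_totalNumber (Ls j) t' U μ) hInj hlt (h1 j) hcap hcut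

/-- **The tangent chord for torus-limit ground states: the `μ`-terms cancel.** A TANGENT floor row
`SourcedEnergyLowerRow t′ U μ 0 q L₀ (ℓ − n·μ)` at `h = 0` (a density-`n` certificate with filling multiplier `μ`, read
grand-canonically) and a MEAN-DENSITY cap row `SourcedEnergyUpperRow t′ U μ h q L₁ (u − n·μ)` AT the field (a trial state
of mean density `n`, `PinningFieldTangentChord.sourcedTorusEnergyUpperRow_of_meanDensity_trial`) give, for every
torus-limit ground state of `dWaveSourceTorusTT' · t′ U μ h` along sides with `q ∣ Ls j`, `(ℓ − u)/(2h) ≤ Re ω(P₀^d)`.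
[cite: KomaTasaki1994, §1] [cite: Griffiths1966, §II] -/
theorem le_re_expect_localPairAt_of_tangentRow_of_meanDensityCap_TT' (μ : ℚ) {q L₀ L₁ : ℕ}
    {ω : InfVolFermionState 2} {ψ : ∀ L, Fock (Orb (FermionTorus 2 L))} {Ls : ℕ → ℕ} (hω : ω.IsTorusLimitOf ψ Ls)
    (hLs : Tendsto Ls atTop atTop) (hq : ∀ j, q ∣ Ls j) {h : ℝ} (hh : 0 < h)
    (hgs : ∀ (j : ℕ) [NeZero (Ls j)], dWaveSourceTorusTT' (Ls j) t' U ((μ : ℚ) : ℝ) h *ᵥ ψ (Ls j) =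
      (((dWaveSourceTorusTT' (Ls j) t' U ((μ : ℚ) : ℝ) h).groundEnergy : ℝ) : ℂ) • ψ (Ls j))
    (h1 : ∀ j, star (ψ (Ls j)) ⬝ᵥ ψ (Ls j) = 1) {ℓ u n : ℚ}
    (hlo : SourcedEnergyLowerRow t' U ((μ : ℚ) : ℝ) 0 q L₀ (ℓ - n * μ))
    (hhi : SourcedEnergyUpperRow t' U ((μ : ℚ) : ℝ) h q L₁ (u - n * μ)) :
    (((ℓ : ℚ) : ℝ) - u) / (2 * h) ≤ (ω.expect (pairRegion (insert (0 : Site 2) unitSteps) 0)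
        (localPairAt (insert (0 : Site 2) unitSteps) dWaveFormFactor 0)).re := by
  have key := le_re_expect_localPairAt_of_dWaveSourceTT'_groundStates_of_rows ((μ : ℚ) : ℝ) hω hLs hq hgs h1 hh
    hlo hhi
  have harith : ((((ℓ - n * μ : ℚ)) : ℝ) - ((u - n * μ : ℚ) : ℝ)) / (2 * (h - 0)) = (((ℓ : ℚ) : ℝ) - u) / (2 * h) := by
    push_cast
    ring
  rwa [harith] at key

end Rows

/-! ### §3 Today's cap at `t′`: a canonical source-free UPPER row caps every source -/

section Inputs

variable (t' : ℝ)

/-- **The cap at ANY source `h` from a canonical source-free UPPER row at `t′`** (Legendre + «the source never raises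
the energy»): for `U ≥ 0`, a density `0 ≤ n < 2` with `energyDensityTT' 1 t′ U n ≤ hi`, any `μ`, any real `h` and any
`u > hi − μn`, `E₀(dWaveSourceTorusTT' L t′ U μ h) ≤ u·L²` for all large `L`, in the `∃ L₀, ∀ L ≥ L₀` shape.
[cite: KomaTasaki1994, §1] [cite: Tasaki2020, §2.1] -/
theorem exists_groundEnergy_dWaveSourceTorusTT'_le_of_canonical_upper {U : ℝ} (hU : 0 ≤ U) (μ : ℝ) {n : ℝ}
    (hn0 : 0 ≤ n) (hn2 : n < 2) {hi : ℝ} (hhi : energyDensityTT' 1 t' U n ≤ hi) (h : ℝ) {u : ℝ}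
    (hu : hi - μ * n < u) :
    ∃ L₀ : ℕ, ∀ (L : ℕ) [NeZero L], L₀ ≤ L → (dWaveSourceTorusTT' L t' U μ h).groundEnergy ≤ u * (L : ℝ) ^ 2 := by
  have hev := eventually_groundEnergy_dWaveSourceTorusTT'_zero_le t' hU μ hn0 hn2 (u₀ := u) (by linarith)
  obtain ⟨N, hN⟩ := Filter.eventually_atTop.1 hev
  refine ⟨N + 1, fun L _ hL => ?_⟩
  obtain ⟨k, rfl⟩ : ∃ k, L = k + 1 := ⟨L - 1, by omega⟩
  exact (groundEnergy_dWaveSourceTorusTT'_le (L := k + 1) t' U μ h).trans (hN k (by omega))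

/-- **UPPER bracket fed by today's table at `t′`** (a canonical energy UPPER row `e(1,t′,U,n) ≤ hi` at ANY density `n`, a
free `μ`, and ONE sourced LOWER certificate `ℓ·L² ≤ E₀(A_L(h₂))` at `h₂ > h`): every torus-limit ground state `ω` of
`dWaveSourceTorusTT' · t′ U μ h` has `Re ω(P₀^d) ≤ (hi − μn − ℓ)/(2(h₂ − h))` — the every-ground-state companion of the
order-parameter ceiling `dWaveOrderParameterTT'_le_of_canonical_upper_of_sourced_lower`. [cite: KomaTasaki1994, §1] -/
theorem re_expect_localPairAt_le_of_canonical_upper_of_sourced_lower_TT' {U : ℝ} (hU : 0 ≤ U) (μ : ℝ) {n : ℝ}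
    (hn0 : 0 ≤ n) (hn2 : n < 2) {hi : ℝ} (hhi : energyDensityTT' 1 t' U n ≤ hi)
    {ω : InfVolFermionState 2} {ψ : ∀ L, Fock (Orb (FermionTorus 2 L))} {Ls : ℕ → ℕ} (hω : ω.IsTorusLimitOf ψ Ls)
    (hLs : Tendsto Ls atTop atTop) {h : ℝ}
    (hgs : ∀ (j : ℕ) [NeZero (Ls j)], dWaveSourceTorusTT' (Ls j) t' U μ h *ᵥ ψ (Ls j) =
      (((dWaveSourceTorusTT' (Ls j) t' U μ h).groundEnergy : ℝ) : ℂ) • ψ (Ls j))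
    (h1 : ∀ j, star (ψ (Ls j)) ⬝ᵥ ψ (Ls j) = 1) {h₂ ℓ : ℝ} (hlt : h < h₂)
    (hcut : ∃ L₀ : ℕ, ∀ (L : ℕ) [NeZero L], L₀ ≤ L → ℓ * (L : ℝ) ^ 2 ≤ (dWaveSourceTorusTT' L t' U μ h₂).groundEnergy) :
    (ω.expect (pairRegion (insert (0 : Site 2) unitSteps) 0)
        (localPairAt (insert (0 : Site 2) unitSteps) dWaveFormFactor 0)).re ≤ (hi - μ * n - ℓ) / (2 * (h₂ - h)) := by
  have hδ : 0 < 2 * (h₂ - h) := by linarith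
  refine le_of_forall_pos_le_add fun ε hε => ?_
  have hcap := exists_groundEnergy_dWaveSourceTorusTT'_le_of_canonical_upper t' hU μ hn0 hn2 hhi h
    (u := hi - μ * n + ε * (2 * (h₂ - h))) (by nlinarith [mul_pos hε hδ])
  have hle := re_expect_localPairAt_le_of_dWaveSourceTT'_groundStates hω hLs hgs h1 hlt hcap hcut
  have heq : (hi - μ * n + ε * (2 * (h₂ - h)) - ℓ) / (2 * (h₂ - h)) = (hi - μ * n - ℓ) / (2 * (h₂ - h)) + ε := by
    rw [show hi - μ * n + ε * (2 * (h₂ - h)) - ℓ = (hi - μ * n - ℓ) + ε * (2 * (h₂ - h)) by ring, add_div,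
      mul_div_cancel_right₀ ε hδ.ne']
  rw [heq] at hle
  exact hle

end Inputs

/-! ### §4 What the FLOOR side needs at `t′` (honesty node) -/

section Honesty

/-- **A cut below `h` never beats a cap inherited from the source-free problem** (`t–t′` torus): if
`ℓ·L² ≤ E₀(A_L(h₁))` and `E₀(A_L(0)) ≤ u₀·L²` on one torus then `ℓ ≤ u₀` (`E₀(A_L(h₁)) ≤ E₀(A_L(0))`, the source never
raises the energy). [cite: KomaTasaki1994, §1] -/
theorem cut_le_cap_of_sourceFree_cap_TT' (L : ℕ) [NeZero L] (t' U μ : ℝ) {h₁ ℓ u₀ : ℝ}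
    (hcut : ℓ * (L : ℝ) ^ 2 ≤ (dWaveSourceTorusTT' L t' U μ h₁).groundEnergy)
    (hcap0 : (dWaveSourceTorusTT' L t' U μ 0).groundEnergy ≤ u₀ * (L : ℝ) ^ 2) : ℓ ≤ u₀ := by
  have hE := groundEnergy_dWaveSourceTorusTT'_le (L := L) t' U μ h₁
  have hL : (0 : ℝ) < (L : ℝ) ^ 2 := cast_sq_pos_of_neZero L
  exact le_of_mul_le_mul_right ((hcut.trans hE).trans hcap0) hL

/-- … and the vacuity made explicit: under a source-free cap reused at `h`, the floor value is `≤ 0` — a positive floor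
on the sourced pair amplitude at `t′` requires a cap at `h` from a SOURCED variational state certified strictly BELOW the
certified source-free lower edge. [folklore] -/
theorem floor_nonpos_of_sourceFree_cap_TT' (L : ℕ) [NeZero L] (t' U μ : ℝ) {h₁ h ℓ u₀ : ℝ} (hlt : h₁ < h)
    (hcut : ℓ * (L : ℝ) ^ 2 ≤ (dWaveSourceTorusTT' L t' U μ h₁).groundEnergy)
    (hcap0 : (dWaveSourceTorusTT' L t' U μ 0).groundEnergy ≤ u₀ * (L : ℝ) ^ 2) :
    (ℓ - u₀) / (2 * (h - h₁)) ≤ 0 :=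
  div_nonpos_of_nonpos_of_nonneg (sub_nonpos.2 (cut_le_cap_of_sourceFree_cap_TT' L t' U μ hcut hcap0)) (by linarith)

end Honesty

end Summit.Ventures.CertifiedManyBodySolver.Observables

end
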